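import Mathlib

/-!
# Line `Sketch` for the crux `RobustYangMillsRG` (stmt-QuantumFields-14958) — stub
# `stub_hypercubicQuadraticForms` (card `schwarz-flattening`, (T2) flattening engine)

Crux: `Summit.QuantumFields.QCD.Theses.NestedDissectionSea.RobustYangMillsRG` (shared verbatim with
`HeavyThresholdYMBridge`), item stmt-QuantumFields-14958; skeleton
`Cruxes/RobustYangMillsRG/Lines/Sketch.lean` (lead `prover-line-stmt-QuantumFields-14958-0`).
This file closes the registered stub `stub_hypercubicQuadraticForms`, the (T2) flattening-engine
statement `marginalIsCouplingShift` of card `schwarz-flattening`: a quadratic form in the plane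
variables `F : Plane d → ℝ` (the zero-momentum field-strength components `F_{μν}`) that is invariant
under every axis reflection and every axis permutation is a multiple of `∑ s, F s ^ 2`, i.e. the
zero-momentum quadratic part of a lattice-symmetric remainder is a pure shift of the Wilson coupling.

Proof (pure finite-dimensional linear algebra): write `Q F = ∑ s t, F s F t c s t` with
`c s t = B eₛ eₜ` (`LinearMap.toMatrix₂'`); for two distinct planes `s ≠ t` an axis `μ ∈ s ∖ t`
exists, and reflection invariance at `μ` applied to `eₛ + eₜ` (which the reflection sends to
`-eₛ + eₜ`) gives `c s t + c t s = 0` (polarisation); for two planes `s, t` a product of two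
transpositions carries `s` to `t`, and permutation invariance applied to `eₜ` gives `c s s = c t t`;
finally the antisymmetric off-diagonal part drops out of `Q F` (sum the double sum with its
transpose), leaving `c s₀ s₀ * ∑ s, F s ^ 2`.
-/

set_option autoImplicit false

open scoped BigOperators

namespace Summit.QuantumFields.QCD.Cruxes.RobustYangMillsRG.Sketch

/-- Unordered coordinate planes `{μ, ν}` of `ℝ^d` (indices of the field-strength components
`F_{μν}` at zero momentum). -/
abbrev Plane (d : ℕ) : Type := {s : Finset (Fin d) // s.card = 2}

/-- Axis permutations act on planes. -/
def Plane.perm {d : ℕ} (π : Equiv.Perm (Fin d)) (s : Plane d) : Plane d :=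
  ⟨s.1.map π.toEmbedding, by rw [Finset.card_map]; exact s.2⟩

/-- **Hypercubic-invariant quadratic forms in the field strength are coupling shifts**
(`marginalIsCouplingShift` of card `schwarz-flattening`): a quadratic form in the plane variables
`F : Plane d → ℝ` that is invariant under every axis reflection (`F_s ↦ -F_s` for the planes `s ∋ μ`)
and every axis permutation (`F_s ↦ F_{π s}`) is a multiple of `Σ_s F_s²` — the zero-momentum quadratic
part of a lattice-symmetric remainder is a pure shift of the Wilson coupling (Clifford theory for the
hyperoctahedral group `B_d` on `Λ²ℝ^d`: sign characters kill the cross terms, transitivity on planes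
equalises the diagonal). -/
def HypercubicQuadraticForms : Prop :=
  ∀ (d : ℕ) (Q : (Plane d → ℝ) → ℝ),
    (∃ B : (Plane d → ℝ) →ₗ[ℝ] (Plane d → ℝ) →ₗ[ℝ] ℝ, ∀ F, Q F = B F F) →
    (∀ (μ : Fin d) (F : Plane d → ℝ), Q (fun s => if μ ∈ s.1 then -F s else F s) = Q F) →
    (∀ (π : Equiv.Perm (Fin d)) (F : Plane d → ℝ), Q (fun s => F (Plane.perm π s)) = Q F) →
      ∃ a : ℝ, ∀ F, Q F = a * ∑ s, F s ^ 2

/-! ### Planes: separation, the permutation action -/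

/-- Two distinct planes are separated by an axis: some `μ` lies in `s` but not in `t`
(both have two elements, so `s ⊆ t` would force `s = t`). -/
theorem Plane.exists_mem_not_mem {d : ℕ} {s t : Plane d} (h : s ≠ t) :
    ∃ μ, μ ∈ s.1 ∧ μ ∉ t.1 := by
  have hns : ¬ s.1 ⊆ t.1 := fun hsub =>
    h (Subtype.ext (Finset.eq_of_subset_of_card_le hsub (s.2.trans t.2.symm).ge))
  simpa only [Finset.not_subset] using hns

/-- The action of an axis permutation on planes is injective. -/
theorem Plane.perm_injective {d : ℕ} (π : Equiv.Perm (Fin d)) :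
    Function.Injective (Plane.perm π) := by
  intro s t h
  have h' : s.1.map π.toEmbedding = t.1.map π.toEmbedding := congrArg Subtype.val h
  exact Subtype.ext (Finset.map_inj.mp h')

/-- Axis permutations act transitively on planes: `{a, b}` is carried to `{a', b'}` by the product of
the transposition `(a a')` with the transposition moving the image of `b` to `b'` (which fixes `a'`). -/
theorem Plane.exists_perm_eq {d : ℕ} (s t : Plane d) :
    ∃ π : Equiv.Perm (Fin d), Plane.perm π s = t := by
  obtain ⟨a, b, hab, hs⟩ := Finset.card_eq_two.mp s.2
  obtain ⟨a', b', hab', ht⟩ := Finset.card_eq_two.mp t.2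
  have hb : Equiv.swap a a' b ≠ a' := by
    intro h
    apply hab
    apply (Equiv.swap a a').injective
    rw [h, Equiv.swap_apply_left]
  refine ⟨(Equiv.swap a a').trans (Equiv.swap (Equiv.swap a a' b) b'), Subtype.ext ?_⟩
  show s.1.map (Equiv.toEmbedding _) = t.1
  rw [hs, ht, Finset.map_insert, Finset.map_singleton]
  simp only [Equiv.coe_toEmbedding, Equiv.trans_apply, Equiv.swap_apply_left]
  rw [Equiv.swap_apply_of_ne_of_ne hb.symm hab']

/-! ### The two test-vector computations -/

/-- The axis reflection at `μ ∈ s ∖ t` sends the test vector `eₛ + eₜ` to `-eₛ + eₜ`. -/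
theorem Plane.reflect_single_add_single {d : ℕ} {s t : Plane d} (hst : s ≠ t) {μ : Fin d}
    (hμs : μ ∈ s.1) (hμt : μ ∉ t.1) :
    (fun s' : Plane d => if μ ∈ s'.1 then -(Pi.single s 1 + Pi.single t 1 : Plane d → ℝ) s'
      else (Pi.single s 1 + Pi.single t 1 : Plane d → ℝ) s') =
      -Pi.single s 1 + Pi.single t 1 := by
  funext s'
  by_cases h₁ : s' = s
  · subst h₁
    simp [hμs, hst]
  · by_cases h₂ : s' = t
    · subst h₂
      simp [hμt, h₁]
    · simp [h₁, h₂]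

/-- Pulling the indicator `eₜ` back along a plane permutation carrying `s` to `t` gives `eₛ`. -/
theorem Plane.single_comp_perm {d : ℕ} {π : Equiv.Perm (Fin d)} {s t : Plane d}
    (h : Plane.perm π s = t) :
    (fun s' : Plane d => (Pi.single t (1 : ℝ) : Plane d → ℝ) (Plane.perm π s')) = Pi.single s 1 := by
  funext s'
  by_cases hs' : s' = s
  · subst hs'
    simp [h]
  · have hne : Plane.perm π s' ≠ t := fun h' => hs' (Plane.perm_injective π (h'.trans h.symm))
    simp [hne, hs']

/-! ### The combinatorial core -/

/-- A double sum `∑ s t, F s F t c s t` whose off-diagonal coefficients are antisymmetric and whose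
diagonal is constant collapses to `c s₀ s₀ * ∑ s, F s ^ 2` (add the sum to its transpose). -/
theorem sum_sum_eq_mul_sum_sq {ι : Type*} [Fintype ι] (c : ι → ι → ℝ)
    (hcross : ∀ s t, s ≠ t → c s t + c t s = 0) (s₀ : ι) (hdiag : ∀ s, c s s = c s₀ s₀)
    (F : ι → ℝ) : ∑ s, ∑ t, F s * F t * c s t = c s₀ s₀ * ∑ s, F s ^ 2 := by
  have hswap : ∑ s, ∑ t, F s * F t * c s t = ∑ s, ∑ t, F t * F s * c t s := Finset.sum_comm
  have key : ∑ s, ∑ t, F s * F t * c s t + ∑ s, ∑ t, F t * F s * c t s =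
      2 * (c s₀ s₀ * ∑ s, F s ^ 2) := by
    rw [← Finset.sum_add_distrib, Finset.mul_sum, Finset.mul_sum]
    refine Finset.sum_congr rfl fun s _ => ?_
    rw [← Finset.sum_add_distrib, Finset.sum_eq_single_of_mem s (Finset.mem_univ s)]
    · rw [hdiag s]
      ring
    · intro t _ hts
      calc F s * F t * c s t + F t * F s * c t s = F s * F t * (c s t + c t s) := by ring
        _ = 0 := by rw [hcross s t (Ne.symm hts), mul_zero]
  linarith [hswap, key]

/-! ### The registered stub -/

/-- **stub_hypercubicQuadraticForms** — the registered stub, closed: coefficients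
`c s t = B eₛ eₜ` of the bilinear form in the basis of plane indicators (`LinearMap.toMatrix₂'`);
reflection invariance at an axis separating two planes kills the cross terms `c s t + c t s`
(polarisation on `eₛ + eₜ`), a permutation carrying one plane to another equalises the diagonal, and
the antisymmetric remainder drops out of `Q F`. -/
theorem stub_hypercubicQuadraticForms : HypercubicQuadraticForms := by
  rintro d Q ⟨B, hB⟩ hrefl hperm
  -- expansion of `Q` in the basis of plane indicators
  have hexp : ∀ F : Plane d → ℝ,
      Q F = ∑ s, ∑ t, F s * F t * B (Pi.single s 1) (Pi.single t 1) := by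
    intro F
    rw [hB]
    conv_lhs => rw [← Matrix.toLinearMap₂'_toMatrix' (R := ℝ) B]
    rw [Matrix.toLinearMap₂'_apply]
    simp only [LinearMap.toMatrix₂'_apply, smul_eq_mul, mul_assoc]
  -- (i) cross terms vanish: reflection at an axis `μ ∈ s ∖ t`, polarised on `eₛ + eₜ`
  have hcross : ∀ s t : Plane d, s ≠ t →
      B (Pi.single s 1) (Pi.single t 1) + B (Pi.single t 1) (Pi.single s 1) = 0 := by
    intro s t hst
    obtain ⟨μ, hμs, hμt⟩ := Plane.exists_mem_not_mem hst
    have key : Q (-Pi.single s 1 + Pi.single t 1) = Q (Pi.single s 1 + Pi.single t 1) :=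
      (congrArg Q (Plane.reflect_single_add_single hst hμs hμt)).symm.trans
        (hrefl μ (Pi.single s 1 + Pi.single t 1))
    rw [hB, hB] at key
    simp only [map_add, map_neg, LinearMap.add_apply, LinearMap.neg_apply] at key
    linarith
  rcases isEmpty_or_nonempty (Plane d) with hE | ⟨⟨s₀⟩⟩
  · exact ⟨0, fun F => by simp [hexp]⟩
  · refine ⟨B (Pi.single s₀ 1) (Pi.single s₀ 1), fun F => ?_⟩
    -- (ii) diagonal terms agree: a permutation carrying `s` to `s₀`, applied to `e_{s₀}`
    have hdiag : ∀ s : Plane d,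
        B (Pi.single s 1) (Pi.single s 1) = B (Pi.single s₀ 1) (Pi.single s₀ 1) := by
      intro s
      obtain ⟨π, hπ⟩ := Plane.exists_perm_eq s s₀
      have key : Q (Pi.single s 1) = Q (Pi.single s₀ 1) :=
        (congrArg Q (Plane.single_comp_perm hπ)).symm.trans (hperm π (Pi.single s₀ 1))
      rwa [hB, hB] at key
    -- (iii) assemble
    rw [hexp]
    exact sum_sum_eq_mul_sum_sq (fun s t => B (Pi.single s 1) (Pi.single t 1)) hcross s₀ hdiag F

end Summit.QuantumFields.QCD.Cruxes.RobustYangMillsRG.Sketch
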